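import Literature.NumberTheory.Sieve.SmoothCountSaddleRegimeB
import Literature.NumberTheory.Sieve.SmoothLocalBehaviourHTLargeY
import HarnessLib

/-!
# Local behaviour of `Ψ(x, y)` for `y < 8 (log x)³`, and Hildebrand–Tenenbaum's Theorem 3

Feeding the saddle-point asymptotic formula of `SmoothCountSaddleRegimeB` (Hildebrand–Tenenbaum's Theorem 1 in
the range `y ≤ 8 (log x)³`, proved there without any zero-free region) into the log-space comparison of the
main terms (`exists_abs_log_mainTerm_sub_le`) gives the local-behaviour estimate
`Ψ(cx, y) = c^{α(x,y)} Ψ(x, y) (1 + O(log y/log x + log y/y))` for `1 ≤ c ≤ y < 8 (log x)³`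
(`exists_local_regimeB`). Combined with `HTLocalBehaviour_of_smallY` (all the other ranges) this proves
the named fact `HTLocalBehaviour` (Hildebrand–Tenenbaum 1986, Theorem 3): `HTLocalBehaviour_holds`.

## References

* [HildebrandTenenbaum1986] A. Hildebrand, G. Tenenbaum, *On integers free of large prime factors*,
  Trans. AMS 296 (1986) 265–290, Theorems 1 and 3, §6.
-/

noncomputable section

open Real Finset Filter

namespace Literature.NumberTheory.Sieve

set_option maxHeartbeats 1600000 in
/-- **Local behaviour for `y < 8 (log x)³`.** There are `C`, `y₀` such that for `y₀ ≤ y ≤ x`,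
`y < 8 (log x)³` and `1 ≤ c ≤ y`:
`|Ψ(cx, y) - c^{α(x,y)} Ψ(x, y)| ≤ C (log y/log x + log y/y) c^{α(x,y)} Ψ(x, y)`.
[cite: HildebrandTenenbaum1986, Theorem 3 (range y ≤ (log x)³⁺) and §6] -/
theorem exists_local_regimeB :
    ∃ C : ℝ, ∃ y₀ : ℕ, ∀ (x : ℝ) (y : ℕ) (c : ℝ), y₀ ≤ y → (y : ℝ) ≤ x →
      (y : ℝ) < 8 * Real.log x ^ 3 → 1 ≤ c → c ≤ y →
      |((Nat.smoothNumbersUpTo ⌊c * x⌋₊ (y + 1)).card : ℝ) -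
          c ^ saddlePoint x y * ((Nat.smoothNumbersUpTo ⌊x⌋₊ (y + 1)).card : ℝ)| ≤
        C * (Real.log y / Real.log x + Real.log y / y) *
          (c ^ saddlePoint x y * ((Nat.smoothNumbersUpTo ⌊x⌋₊ (y + 1)).card : ℝ)) := by
  obtain ⟨CB, yB, hB⟩ := RegimeB.exists_card_smooth_saddle_regimeB
  obtain ⟨K, yK, hK0, hyK2, hM⟩ := exists_abs_log_mainTerm_sub_le
  set CB' := max CB 0 with hCB'
  have hCB'0 : 0 ≤ CB' := le_max_right _ _
  set Kstar : ℝ := 4 * CB' + K with hKstar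
  have hKstar0 : 0 < Kstar := by positivity
  have hev := (RegimeB.eventually_log_pow_le 1 (s := 1 / 3) (c := 1 / (3 * Kstar)) (by norm_num)
    (by positivity)).and (eventually_ge_atTop (16 : ℝ))
  obtain ⟨Z, hZ⟩ := Filter.eventually_atTop.1 hev
  refine ⟨2 * Kstar, max (max yB yK) ⌈Z⌉₊, ?_⟩
  intro x y c hy hyx h8 hc1 hcy
  have hyB : yB ≤ y := le_trans (le_trans (le_max_left _ _) (le_max_left _ _)) hy
  have hyK : yK ≤ y := le_trans (le_trans (le_max_right _ _) (le_max_left _ _)) hy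
  have hyZ : Z ≤ (y : ℝ) := (Nat.le_ceil Z).trans (by exact_mod_cast le_trans (le_max_right _ _) hy)
  obtain ⟨hEv, hy16r⟩ := hZ _ hyZ
  rw [pow_one] at hEv
  have hy0 : (0 : ℝ) < y := by linarith
  have hy1 : (1 : ℝ) < y := by linarith
  have hy2 : 2 ≤ y := by exact_mod_cast (show (2 : ℝ) ≤ y by linarith)
  set L := Real.log y with hL
  have hL1 : 1 < L := by
    rw [hL, Real.lt_log_iff_exp_lt hy0]
    exact lt_of_lt_of_le (Real.exp_one_lt_d9.trans (by norm_num)) hy16r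
  have hL0 : 0 < L := by linarith
  have hx1 : 1 < x := by linarith
  have hx0 : 0 < x := by linarith
  have hc0 : 0 < c := by linarith
  have hcx0 : 0 < c * x := by positivity
  have hlogx0 : 0 < Real.log x := Real.log_pos hx1
  have hycx : (y : ℝ) ≤ c * x := hyx.trans (le_mul_of_one_le_left hx0.le hc1)
  have hcx1 : 1 < c * x := lt_of_lt_of_le hy1 hycx
  have hlogcx : Real.log x ≤ Real.log (c * x) := Real.log_le_log hx0 (le_mul_of_one_le_left hx0.le hc1)
  have hlogcx0 : 0 < Real.log (c * x) := lt_of_lt_of_le hlogx0 hlogcx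
  -- `t = y^{1/3} < 2 log x`, so `Q := L/log x + L/y ≤ 3L/t ≤ 1/Kstar`
  set t3 : ℝ := (y : ℝ) ^ (1 / 3 : ℝ) with ht3
  have ht30 : 0 < t3 := Real.rpow_pos_of_pos hy0 _
  have ht3cube : t3 ^ 3 = y := by
    rw [ht3, ← Real.rpow_natCast, ← Real.rpow_mul hy0.le]; norm_num
  have ht31 : 1 ≤ t3 := Real.one_le_rpow hy1.le (by norm_num)
  have ht3y : t3 ≤ y := by
    calc t3 = t3 ^ 1 := (pow_one _).symm
      _ ≤ t3 ^ 3 := pow_le_pow_right₀ ht31 (by norm_num)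
      _ = y := ht3cube
  have ht3logx : t3 ≤ 2 * Real.log x := by
    have h1 : t3 ^ 3 < (2 * Real.log x) ^ 3 := by
      rw [ht3cube]; have : (2 * Real.log x) ^ 3 = 8 * Real.log x ^ 3 := by ring
      linarith only [this, h8]
    exact (lt_of_pow_lt_pow_left₀ 3 (by positivity) h1).le
  set Q : ℝ := L / Real.log x + L / y with hQ
  have hQ0 : 0 ≤ Q := by positivity
  have hQle : Q ≤ 3 * L / t3 := by
    have h1 : L / Real.log x ≤ 2 * L / t3 := by
      rw [div_le_div_iff₀ hlogx0 ht30]; nlinarith only [ht3logx, hL0]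
    have h2 : L / y ≤ L / t3 := div_le_div_of_nonneg_left hL0.le ht30 ht3y
    have h3 : 2 * L / t3 + L / t3 = 3 * L / t3 := by ring
    linarith only [h1, h2, h3]
  have hKQ : Kstar * Q ≤ 1 := by
    have h1 : 3 * Kstar * L ≤ t3 := by
      have := hEv; rw [div_mul_eq_mul_div, one_mul, le_div_iff₀ (by positivity)] at this; linarith
    have h2 : Kstar * (3 * L / t3) ≤ 1 := by
      rw [mul_div_assoc', div_le_one ht30]; linarith only [h1]
    exact (mul_le_mul_of_nonneg_left hQle hKstar0.le).trans h2
  have hCBQ : CB' * Q ≤ 1 / 2 := by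
    have : 2 * CB' ≤ Kstar := by rw [hKstar]; linarith only [hCB'0, hK0]
    nlinarith only [this, hKQ, hQ0, hCB'0]
  -- Theorem 1 at `x` and `cx`
  have hlogcx3 : (y : ℝ) ≤ 8 * Real.log (c * x) ^ 3 := by
    have : Real.log x ^ 3 ≤ Real.log (c * x) ^ 3 := pow_le_pow_left₀ hlogx0.le hlogcx 3
    linarith only [this, h8]
  have hA1 := hB x y hyB hyx h8.le
  have hA2 := hB (c * x) y hyB hycx hlogcx3
  rw [← hL] at hA1 hA2
  have hM1 := hM x y c hyK hyx hc1 hcy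
  rw [← hL] at hM1
  set α := saddlePoint x y with hα
  set α₂ := saddlePoint (c * x) y with hα₂
  have hαpos : 0 < α := saddlePoint_pos hx1 hy2
  have hα₂pos : 0 < α₂ := saddlePoint_pos hcx1 hy2
  set M₁ := x ^ α * smoothZeta α y / (α * Real.sqrt (2 * Real.pi * saddlePhi₂ α y)) with hM₁
  set M₂ := (c * x) ^ α₂ * smoothZeta α₂ y / (α₂ * Real.sqrt (2 * Real.pi * saddlePhi₂ α₂ y)) with hM₂
  have hM₁0 : 0 < M₁ := by
    have := smoothZeta_pos (y := y) hαpos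
    have := saddlePhi₂_pos hy2 hαpos
    positivity
  have hM₂0 : 0 < M₂ := by
    have := smoothZeta_pos (y := y) hα₂pos
    have := saddlePhi₂_pos hy2 hα₂pos
    positivity
  have hEA1 : CB * (L / Real.log x + L / y) ≤ CB' * Q := mul_le_mul_of_nonneg_right (le_max_left _ _) hQ0
  have hEA2 : CB * (L / Real.log (c * x) + L / y) ≤ CB' * Q := by
    have h1 : L / Real.log (c * x) ≤ L / Real.log x := div_le_div_of_nonneg_left hL0.le hlogx0 hlogcx
    have h2 : 0 ≤ L / Real.log (c * x) + L / y := by positivity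
    calc CB * (L / Real.log (c * x) + L / y) ≤ CB' * (L / Real.log (c * x) + L / y) :=
          mul_le_mul_of_nonneg_right (le_max_left _ _) h2
      _ ≤ CB' * Q := mul_le_mul_of_nonneg_left (by rw [hQ]; linarith only [h1]) hCB'0
  obtain ⟨hΨ1pos, hL3'⟩ := abs_log_sub_log_le_of_abs_sub_le hM₁0 (by positivity) hCBQ
    (hA1.trans (mul_le_mul_of_nonneg_right hEA1 hM₁0.le))
  obtain ⟨hΨ2pos, hL4'⟩ := abs_log_sub_log_le_of_abs_sub_le hM₂0 (by positivity) hCBQ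
    (hA2.trans (mul_le_mul_of_nonneg_right hEA2 hM₂0.le))
  have hlM₁ : Real.log M₁ = α * Real.log x + Real.log (smoothZeta α y) - Real.log α -
      1 / 2 * Real.log (2 * Real.pi * saddlePhi₂ α y) := log_mainTerm_eq hx1 hy2 hαpos
  have hlM₂ : Real.log M₂ = α₂ * Real.log (c * x) + Real.log (smoothZeta α₂ y) - Real.log α₂ -
      1 / 2 * Real.log (2 * Real.pi * saddlePhi₂ α₂ y) := log_mainTerm_eq hcx1 hy2 hα₂pos
  have hL5 : |Real.log M₂ - Real.log M₁ - α * Real.log c| ≤ K * Q := by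
    rw [hlM₁, hlM₂]
    refine hM1.trans (mul_le_mul_of_nonneg_left ?_ hK0.le)
    rw [hQ]; linarith only [div_nonneg hL0.le hy0.le]
  set Ψ₁ := ((Nat.smoothNumbersUpTo ⌊x⌋₊ (y + 1)).card : ℝ) with hΨ₁
  set Ψ₂ := ((Nat.smoothNumbersUpTo ⌊c * x⌋₊ (y + 1)).card : ℝ) with hΨ₂
  have hT : Real.log Ψ₂ - Real.log Ψ₁ - Real.log (c ^ α) =
      (Real.log Ψ₂ - Real.log M₂) - (Real.log Ψ₁ - Real.log M₁) +
        (Real.log M₂ - Real.log M₁ - α * Real.log c) := by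
    rw [Real.log_rpow hc0]; ring
  have hTabs : |Real.log Ψ₂ - Real.log Ψ₁ - Real.log (c ^ α)| ≤ Kstar * Q := by
    rw [hT]
    have e : Kstar * Q = 2 * (CB' * Q) + 2 * (CB' * Q) + K * Q := by rw [hKstar]; ring
    rw [e]
    exact (abs_add_le _ _).trans (add_le_add ((abs_sub _ _).trans (add_le_add hL4' hL3')) hL5)
  have hcα : 0 < c ^ α := Real.rpow_pos_of_pos hc0 _
  have hfin := abs_sub_mul_le_of_abs_log_le hΨ1pos hΨ2pos hcα hKQ hTabs
  refine hfin.trans (mul_le_mul_of_nonneg_right (le_of_eq ?_) (mul_nonneg hcα.le hΨ1pos.le))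
  rw [hQ]; ring

/-- **Hildebrand–Tenenbaum's Theorem 3** (local behaviour of `Ψ(x, y)`): the named fact `HTLocalBehaviour`
holds. The range `y < 8 (log x)³` is `exists_local_regimeB`; all larger `y` are handled in
`HTLocalBehaviour_of_smallY` (ranges `(log x)³⁺ ≤ y ≤ x`). The proof avoids zero-free regions of `ζ`
altogether (the saddle-point formula is established with weaker, elementary decay estimates for
`ζ(s, y)` and a Gaussian smoothing of the Perron integral).
[cite: HildebrandTenenbaum1986, Theorem 3] -/
theorem HTLocalBehaviour_holds : HTLocalBehaviour := by
  obtain ⟨C, y₀, hB⟩ := exists_local_regimeB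
  exact HTLocalBehaviour_of_smallY ⟨C, y₀, hB⟩

end Literature.NumberTheory.Sieve

end
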